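import Literature.MathematicalPhysics.QuantumLattice.KomaPiFluxNearestNeighbourBound
import Literature.MathematicalPhysics.QuantumLattice.HubbardHubbardModelEtaPairingProofs
import HarnessLib

/-!
# The variational ground-energy bound (Koma 2022, Appendix B, (B.13)–(B.18)) and (6.36)

T. Koma, *Nambu–Goldstone modes for superconducting lattice fermions*, arXiv:2201.13135 (2022)
[Koma2022], Appendix B: the trial state `Φ_var = Π_x 2^{-1/2}(1 ± a†_{x↑}a†_{x↓})|0⟩` ((B.16), a
product of `η`-doublet states, staggered in Koma's frame) has no hopping energy and saturates the
pair interaction, giving `E₀ ≤ ⟨Φ_var, H Φ_var⟩ = -dg|Λ|/2` ((B.17)–(B.18)) and thereby the lower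
bound (6.36) on the nearest-neighbour `η` correlation.

In the Lieb frame of this series we use, instead of the product state, Yang's `η`-PAIRING STATE
`ψ_m = (η†)^m|0⟩` with `m = |Λ|/2` pairs (uniform signs; tree `etaPairingState`), whose pair
correlations are known exactly (`pairAmplitude_etaPairingState`, Yang 1989:
`⟨ψ, Γ⁺_xΓ⁻_y ψ⟩ = m(M-m)/(M(M-1)) ‖ψ‖²`, slightly BETTER than the product state's `¼`). We PROVE

* `PairHopRP.proj_*` — the `η`-doublet projection `P_x = (Γ¹_x)²` fixes `Γ⁺` (`PΓ⁺ = Γ⁺ = Γ⁺P`),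
  commutes with `η†`, fixes the vacuum and hence the `η`-pairing states (`proj_mulVec_etaPairingState`);
* `PairHopRP.proj_mul_annihilation_mul_proj` — `P_b c_{bσ} P_b = 0`, whence the hopping terms have
  zero expectation in any `P`-invariant vector (`star_dotProduct_hop_mulVec_eq_zero`), in particular
  `⟨ψ_m, K(T) ψ_m⟩ = 0` (`star_dotProduct_peierlsHubbard_zero_etaPairingState`; (B.17) "the
  contribution from the hopping Hamiltonian is vanishing");
* `KomaPiFlux.groundEnergy_hamiltonian_le` — **(B.17)–(B.18), Lieb frame**: for even `|Λ| = L^{d+1} ≥ 2`,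
  `E₀(H(κ,U,g,0,0)) ≤ U|Λ|/4 + g(d+1)|Λ|/2` (Koma's `E₀ ≤ -dg|Λ|/2` after the constant shift
  `(d+1)g|Λ|/2` of `KomaPiFluxPrintedModel.orbitalPhaseAut_hamiltonian_eq_printed` at `U = -2(d+1)g`);
* `KomaPiFlux.nearestNeighbour_ge` — **(6.36), finite volume**:
  `g N₁ ≥ g(d+1)|Λ|/2 - {U + 2g(d+1)}₊|Λ|/2 - 4(d+1)κ|Λ| - |Λ| log 4/β`, i.e.
  `E₁ ≥ ½ - {U+2(d+1)g}₊/(2g(d+1)) - 4κ/g - log 4/(βg(d+1))`.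

No named fact.

## References

* [Koma2022] T. Koma, arXiv:2201.13135, (6.36), Appendix B (B.13)–(B.18).
* [Yang1989] C. N. Yang, Phys. Rev. Lett. 63 (1989) 2144, eqs. (7)–(10).
-/

noncomputable section

namespace Literature.MathematicalPhysics.QuantumLattice

open Matrix Finset HubbardWave0 PairHopRP FermionTorus LiebCutRP
open Literature.Probability.LatticeModels
open scoped ComplexOrder

namespace PairHopRP

variable {Λ : Type*} [LinearOrder Λ] [Fintype Λ]

/-! ### The `η`-doublet projection `P_x = (Γ¹_x)²` -/

/-- `c_i c_i = 0` (Pauli). [folklore] -/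
private theorem ann_mul_self (i : Orb Λ) : annihilation i * annihilation i = 0 := by
  have h := congrArg conjTranspose (creation_mul_self i)
  rwa [conjTranspose_mul, creation_conjTranspose, conjTranspose_zero] at h

/-- `(1-n_↑)(1-n_↓) = Γ³ + n_↑n_↓`. [cite: Koma2022, (3.7)–(3.9)] -/
private theorem one_sub_mul_one_sub (x : Λ) :
    (1 - numberOp x 0) * (1 - numberOp x 1) = gammaThree x + numberOp x 0 * numberOp x 1 := by
  rw [gammaThree]; noncomm_ring

/-- `P_x Γ⁺_x = Γ⁺_x`. [cite: Koma2022, (B.14)] -/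
theorem proj_mul_gammaPlus (x : Λ) : gammaOne x * gammaOne x * gammaPlus x = gammaPlus x := by
  calc gammaOne x * gammaOne x * gammaPlus x
      = gammaPlus x * (gammaMinus x * gammaPlus x) + gammaMinus x * (gammaPlus x * gammaPlus x) := by
        rw [gammaOne_mul_self]; noncomm_ring
    _ = gammaPlus x * (gammaThree x + numberOp x 0 * numberOp x 1) := by
        rw [gammaPlus_mul_self, Matrix.mul_zero, add_zero, KomaPiFlux.gammaMinus_mul_gammaPlus, one_sub_mul_one_sub]
    _ = gammaPlus x := by
        rw [Matrix.mul_add, gammaPlus_mul_gammaThree, ← Matrix.mul_assoc, gammaPlus_mul_numberOp, Matrix.zero_mul, add_zero]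

/-- `Γ⁺_x P_x = Γ⁺_x`. [cite: Koma2022, (B.14)] -/
theorem gammaPlus_mul_proj (x : Λ) : gammaPlus x * (gammaOne x * gammaOne x) = gammaPlus x := by
  calc gammaPlus x * (gammaOne x * gammaOne x)
      = gammaPlus x * gammaPlus x * gammaMinus x + gammaPlus x * (gammaMinus x * gammaPlus x) := by
        rw [gammaOne_mul_self]; noncomm_ring
    _ = gammaPlus x * (gammaThree x + numberOp x 0 * numberOp x 1) := by
        rw [gammaPlus_mul_self, Matrix.zero_mul, zero_add, KomaPiFlux.gammaMinus_mul_gammaPlus, one_sub_mul_one_sub]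
    _ = gammaPlus x := by
        rw [Matrix.mul_add, gammaPlus_mul_gammaThree, ← Matrix.mul_assoc, gammaPlus_mul_numberOp, Matrix.zero_mul, add_zero]

/-- `P_x` commutes with every `Γ⁺_y`. [cite: Koma2022, (B.14)] -/
theorem proj_comm_gammaPlus (x y : Λ) : gammaOne x * gammaOne x * gammaPlus y = gammaPlus y * (gammaOne x * gammaOne x) := by
  by_cases hxy : x = y
  · subst hxy; rw [proj_mul_gammaPlus, gammaPlus_mul_proj]
  · have hc : gammaOne x * gammaPlus y = gammaPlus y * gammaOne x := by
      rw [gammaOne, Matrix.add_mul, Matrix.mul_add, gammaPlus_comm x y, gammaMinus_comm_gammaPlus_of_ne hxy]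
    rw [Matrix.mul_assoc, hc, ← Matrix.mul_assoc, hc, Matrix.mul_assoc]

/-- `P_x` commutes with Yang's `η†_ε = Σ_y ε_y Γ⁺_y`. [cite: Yang1989, eq. (7)] -/
theorem proj_comm_etaRaise (x : Λ) (ε : Λ → ℤˣ) :
    gammaOne x * gammaOne x * etaRaise ε = etaRaise ε * (gammaOne x * gammaOne x) := by
  unfold etaRaise
  rw [Finset.mul_sum, Finset.sum_mul]
  refine Finset.sum_congr rfl fun y _ => ?_
  rw [Matrix.mul_smul, Matrix.smul_mul]
  exact congrArg _ (proj_comm_gammaPlus x y)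

/-- `P_x |0⟩ = |0⟩`. [cite: Koma2022, (B.14)] -/
theorem proj_mulVec_vacuum (x : Λ) : (gammaOne x * gammaOne x) *ᵥ (vacuum : Fock (Orb Λ)) = vacuum := by
  have hn : ∀ σ : Fin 2, numberOp x σ *ᵥ (vacuum : Fock (Orb Λ)) = 0 := fun σ => by
    rw [numberOp, ← mulVec_mulVec, annihilation_mulVec_vacuum_holds, mulVec_zero]
  rw [gammaOne_mul_self, KomaPiFlux.gammaPlus_mul_gammaMinus, KomaPiFlux.gammaMinus_mul_gammaPlus, one_sub_mul_one_sub,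
    gammaThree]
  simp only [add_mulVec, sub_mulVec, one_mulVec, ← mulVec_mulVec, hn, mulVec_zero, sub_zero, add_zero, zero_add]

/-- **The `η`-pairing states lie in the `η`-doublet sector**: `P_x ψ_m = ψ_m`. [cite: Yang1989, eq. (7)] -/
theorem proj_mulVec_etaPairingState (x : Λ) (ε : Λ → ℤˣ) (m : ℕ) :
    (gammaOne x * gammaOne x) *ᵥ etaPairingState ε m = etaPairingState ε m := by
  have hc : gammaOne x * gammaOne x * etaRaise ε ^ m = etaRaise ε ^ m * (gammaOne x * gammaOne x) :=
    (Commute.pow_right (show Commute (gammaOne x * gammaOne x) (etaRaise ε) from proj_comm_etaRaise x ε) m).eq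
  rw [etaPairingState, mulVec_mulVec, hc, ← mulVec_mulVec, proj_mulVec_vacuum]

/-! ### Hopping terms have no expectation in the doublet sector -/

/-- `Γ⁻_b c_{bσ} = 0`. [folklore] -/
private theorem gammaMinus_mul_annihilation_self (b : Λ) (σ : Fin 2) : gammaMinus b * annihilation (orb b σ) = 0 := by
  have hσ : σ = 0 ∨ σ = 1 := by fin_cases σ <;> simp
  unfold gammaMinus
  rcases hσ with rfl | rfl
  · rw [Matrix.mul_assoc, ann_mul_self, Matrix.mul_zero]
  · rw [Matrix.mul_assoc, eq_neg_of_add_eq_zero_left (annihilation_anticommute_holds (orb b 0) (orb b 1)), Matrix.mul_neg,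
      ← Matrix.mul_assoc, ann_mul_self, Matrix.zero_mul, neg_zero]

/-- `c_{bσ} Γ⁻_b = 0`. [folklore] -/
private theorem annihilation_self_mul_gammaMinus (b : Λ) (σ : Fin 2) : annihilation (orb b σ) * gammaMinus b = 0 := by
  have hσ : σ = 0 ∨ σ = 1 := by fin_cases σ <;> simp
  unfold gammaMinus
  rcases hσ with rfl | rfl
  · rw [← Matrix.mul_assoc, eq_neg_of_add_eq_zero_left (annihilation_anticommute_holds (orb b 0) (orb b 1)), Matrix.neg_mul,
      Matrix.mul_assoc, ann_mul_self, Matrix.mul_zero, neg_zero]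
  · rw [← Matrix.mul_assoc, ann_mul_self, Matrix.zero_mul]

/-- `Γ⁺_b c_{bσ} Γ⁺_b = 0` (three creators at a two-orbital site). [folklore] -/
private theorem gammaPlus_mul_annihilation_mul_gammaPlus (b : Λ) (σ : Fin 2) :
    gammaPlus b * annihilation (orb b σ) * gammaPlus b = 0 := by
  have hne : orb b (0 : Fin 2) ≠ orb b 1 := fun h => absurd (orb_eq_orb_iff.1 h).2 (by decide)
  have hσ : σ = 0 ∨ σ = 1 := by fin_cases σ <;> simp
  unfold gammaPlus
  rcases hσ with rfl | rfl
  · -- `c†0 c†1 c0 c†0 c†1 = c†0 c†1 (1 - n0) c†1 = -c†0 c†1 c†0 c0 c†1 = c†0 c†0 c†1 c0 c†1 = 0`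
    have e0 : annihilation (orb b 0) * creation (orb b 0) = 1 - creation (orb b 0) * annihilation (orb b 0) := by
      rw [annihilation_mul_creation, if_pos rfl]
    have e2 : creation (orb b 1) * creation (orb b 0) = -(creation (orb b 0) * creation (orb b 1)) :=
      creation_mul_creation_eq_neg _ _
    calc creation (orb b 0) * creation (orb b 1) * annihilation (orb b 0) * (creation (orb b 0) * creation (orb b 1))
        = creation (orb b 0) * creation (orb b 1) * (annihilation (orb b 0) * creation (orb b 0)) * creation (orb b 1) := by
          noncomm_ring
      _ = creation (orb b 0) * (creation (orb b 1) * creation (orb b 1)) -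
            creation (orb b 0) * (creation (orb b 1) * creation (orb b 0)) * annihilation (orb b 0) * creation (orb b 1) := by
          rw [e0]; noncomm_ring
      _ = creation (orb b 0) * creation (orb b 0) * creation (orb b 1) * annihilation (orb b 0) * creation (orb b 1) := by
          rw [creation_mul_self (orb b 1), e2]; noncomm_ring
      _ = 0 := by rw [creation_mul_self, Matrix.zero_mul, Matrix.zero_mul, Matrix.zero_mul]
  · calc creation (orb b 0) * creation (orb b 1) * annihilation (orb b 1) * (creation (orb b 0) * creation (orb b 1))
        = creation (orb b 0) * (creation (orb b 1) * annihilation (orb b 1) * creation (orb b 0)) * creation (orb b 1) := by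
          noncomm_ring
      _ = 0 := by
          rw [number_mul_creation_of_ne (Ne.symm hne), ← Matrix.mul_assoc, ← Matrix.mul_assoc, creation_mul_self, Matrix.zero_mul,
            Matrix.zero_mul, Matrix.zero_mul]

/-- **`P_b c_{bσ} P_b = 0`**: an annihilator changes the site parity. [cite: Koma2022, App. B ((B.17), "vanishing")] -/
theorem proj_mul_annihilation_mul_proj (b : Λ) (σ : Fin 2) :
    gammaOne b * gammaOne b * annihilation (orb b σ) * (gammaOne b * gammaOne b) = 0 := by
  rw [gammaOne_mul_self]
  have h1 := gammaMinus_mul_annihilation_self b σ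
  have h2 := annihilation_self_mul_gammaMinus b σ
  have h3 := gammaPlus_mul_annihilation_mul_gammaPlus b σ
  calc (gammaPlus b * gammaMinus b + gammaMinus b * gammaPlus b) * annihilation (orb b σ) *
        (gammaPlus b * gammaMinus b + gammaMinus b * gammaPlus b)
      = gammaPlus b * (gammaMinus b * annihilation (orb b σ)) * (gammaPlus b * gammaMinus b + gammaMinus b * gammaPlus b) +
          gammaMinus b * (gammaPlus b * annihilation (orb b σ) * gammaPlus b) * gammaMinus b +
          gammaMinus b * gammaPlus b * (annihilation (orb b σ) * gammaMinus b) * gammaPlus b := by noncomm_ring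
    _ = 0 := by rw [h1, h2, h3]; noncomm_ring

/-- `c†_{aτ}` commutes with `P_b` for `a ≠ b` (even operators at different sites commute).
[cite: EsslerEtAl2005, §2.1 eq. (2.2)] [cite: Koma2022, §3] -/
theorem creation_comm_proj {a b : Λ} (hab : a ≠ b) (τ : Fin 2) :
    creation (orb a τ) * (gammaOne b * gammaOne b) = gammaOne b * gammaOne b * creation (orb a τ) := by
  have hne : ∀ σ : Fin 2, orb a τ ≠ orb b σ := fun σ h => hab (orb_eq_orb_iff.1 h).1
  have hp : creation (orb a τ) * gammaPlus b = gammaPlus b * creation (orb a τ) := by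
    rw [gammaPlus]; exact creation_comm_pair _ _ _
  have hm : creation (orb a τ) * gammaMinus b = gammaMinus b * creation (orb a τ) := by
    have h := congrArg conjTranspose (annihilation_comm_pair (hne 0) (hne 1))
    simp only [conjTranspose_mul, creation_conjTranspose, annihilation_conjTranspose] at h
    -- `h : (c_{b1} c_{b0}) c†_a = c†_a (c_{b1} c_{b0})` up to association
    rw [gammaMinus]
    calc creation (orb a τ) * (annihilation (orb b 1) * annihilation (orb b 0))
        = creation (orb a τ) * annihilation (orb b 1) * annihilation (orb b 0) := by rw [Matrix.mul_assoc]
      _ = annihilation (orb b 1) * annihilation (orb b 0) * creation (orb a τ) := by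
          rw [← Matrix.mul_assoc] at h; exact h.symm
  have hc : creation (orb a τ) * gammaOne b = gammaOne b * creation (orb a τ) := by
    rw [gammaOne, Matrix.mul_add, Matrix.add_mul, hp, hm]
  rw [← Matrix.mul_assoc, hc, Matrix.mul_assoc, hc, Matrix.mul_assoc]

/-- **Hopping terms have zero expectation in the doublet sector**: if `P_b ψ = ψ` and `a ≠ b` then
`⟨ψ, c†_{aτ}c_{bσ} ψ⟩ = 0`. [cite: Koma2022, App. B (B.17)] -/
theorem star_dotProduct_hop_mulVec_eq_zero {a b : Λ} (hab : a ≠ b) (τ σ : Fin 2) {ψ : Fock (Orb Λ)}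
    (hψ : (gammaOne b * gammaOne b) *ᵥ ψ = ψ) :
    star ψ ⬝ᵥ ((creation (orb a τ) * annihilation (orb b σ)) *ᵥ ψ) = 0 := by
  have hP : (gammaOne b * gammaOne b)ᴴ = gammaOne b * gammaOne b := by
    rw [conjTranspose_mul, (gammaOne_isHermitian b).eq]
  have h0 : gammaOne b * gammaOne b * (creation (orb a τ) * annihilation (orb b σ) * (gammaOne b * gammaOne b)) = 0 := by
    rw [show gammaOne b * gammaOne b * (creation (orb a τ) * annihilation (orb b σ) * (gammaOne b * gammaOne b)) =
        gammaOne b * gammaOne b * creation (orb a τ) * annihilation (orb b σ) * (gammaOne b * gammaOne b) by noncomm_ring,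
      ← creation_comm_proj hab τ, Matrix.mul_assoc (creation (orb a τ)), Matrix.mul_assoc (creation (orb a τ)),
      proj_mul_annihilation_mul_proj, Matrix.mul_zero]
  conv_lhs => rw [← hψ]
  rw [star_mulVec, hP, mulVec_mulVec, ← dotProduct_mulVec, mulVec_mulVec, h0, zero_mulVec, dotProduct_zero]

section Graph

variable (G : SimpleGraph Λ) [DecidableRel G.Adj]

/-- **The kinetic energy vanishes in the doublet sector**: `⟨ψ, K(T) ψ⟩ = 0` whenever `P_b ψ = ψ` for
all sites `b`. [cite: Koma2022, App. B (B.17)] -/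
theorem star_dotProduct_peierlsHubbard_zero_mulVec (T : Fin 2 → Λ → Λ → ℂ) {ψ : Fock (Orb Λ)}
    (hψ : ∀ b : Λ, (gammaOne b * gammaOne b) *ᵥ ψ = ψ) :
    star ψ ⬝ᵥ (peierlsHubbard G T 0 *ᵥ ψ) = 0 := by
  rw [peierlsHubbard_zero_eq, neg_mulVec, dotProduct_neg, neg_eq_zero, Matrix.sum_mulVec, dotProduct_sum]
  refine Finset.sum_eq_zero fun a _ => ?_
  rw [Matrix.sum_mulVec, dotProduct_sum]
  refine Finset.sum_eq_zero fun b _ => ?_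
  rw [Matrix.sum_mulVec, dotProduct_sum]
  refine Finset.sum_eq_zero fun σ _ => ?_
  split_ifs with hab
  · rw [smul_mulVec, dotProduct_smul, star_dotProduct_hop_mulVec_eq_zero (G.ne_of_adj hab) σ σ (hψ b), smul_zero]
  · rw [zero_mulVec, dotProduct_zero]

end Graph

/-! ### Expectations in the `η`-pairing state -/

/-- `⟨ψ_m, K(T) ψ_m⟩ = 0` for the `η`-pairing states. [cite: Koma2022, App. B (B.17)] -/
theorem star_dotProduct_peierlsHubbard_zero_etaPairingState (G : SimpleGraph Λ) [DecidableRel G.Adj]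
    (T : Fin 2 → Λ → Λ → ℂ) (ε : Λ → ℤˣ) (m : ℕ) :
    star (etaPairingState ε m) ⬝ᵥ (peierlsHubbard G T 0 *ᵥ etaPairingState ε m) = 0 :=
  star_dotProduct_peierlsHubbard_zero_mulVec G T fun b => proj_mulVec_etaPairingState b ε m

/-- `⟨ψ_m, P_x ψ_m⟩ = ‖ψ_m‖²`. [cite: Koma2022, App. B (B.14)] -/
theorem star_dotProduct_proj_etaPairingState (x : Λ) (ε : Λ → ℤˣ) (m : ℕ) :
    star (etaPairingState ε m) ⬝ᵥ ((gammaOne x * gammaOne x) *ᵥ etaPairingState ε m) =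
      star (etaPairingState ε m) ⬝ᵥ etaPairingState ε m := by
  rw [proj_mulVec_etaPairingState]

/-- **The pair-hopping expectation in the uniform `η`-pairing state** (`x ≠ y`):
`⟨ψ_m, (Γ¹_xΓ¹_y + Γ²_xΓ²_y) ψ_m⟩ = 4 · m(M-m)/(M(M-1)) · ‖ψ_m‖²` (Yang's off-diagonal long-range order).
[cite: Yang1989, eqs. (9)–(10)] [cite: Koma2022, App. B (B.14)–(B.17)] -/
theorem star_dotProduct_pairHop_etaPairingState {x y : Λ} (hxy : x ≠ y) (m : ℕ) :
    star (etaPairingState (fun _ : Λ => (1 : ℤˣ)) m) ⬝ᵥ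
        ((gammaOne x * gammaOne y + gammaTwo x * gammaTwo y) *ᵥ etaPairingState (fun _ : Λ => (1 : ℤˣ)) m) =
      ((4 * yangPairAmplitude (Fintype.card Λ) m : ℝ) : ℂ) *
        (star (etaPairingState (fun _ : Λ => (1 : ℤˣ)) m) ⬝ᵥ etaPairingState (fun _ : Λ => (1 : ℤˣ)) m) := by
  set ψ := etaPairingState (fun _ : Λ => (1 : ℤˣ)) m with hψ
  have hxy' : y ≠ x := Ne.symm hxy
  have h1 : star ψ ⬝ᵥ ((gammaPlus x * gammaMinus y) *ᵥ ψ) =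
      ((yangPairAmplitude (Fintype.card Λ) m : ℝ) : ℂ) * (star ψ ⬝ᵥ ψ) := by
    have h := pairAmplitude_etaPairingState (fun _ : Λ => (1 : ℤˣ)) m hxy
    rw [pairAmplitude, expect, ← hψ] at h
    rw [gammaPlus, gammaMinus, ← Matrix.mul_assoc, h]
    simp
  have h2 : star ψ ⬝ᵥ ((gammaMinus x * gammaPlus y) *ᵥ ψ) =
      ((yangPairAmplitude (Fintype.card Λ) m : ℝ) : ℂ) * (star ψ ⬝ᵥ ψ) := by
    have h := pairAmplitude_etaPairingState (fun _ : Λ => (1 : ℤˣ)) m hxy'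
    rw [pairAmplitude, expect, ← hψ] at h
    rw [gammaMinus_comm_gammaPlus_of_ne hxy, gammaPlus, gammaMinus, ← Matrix.mul_assoc, h]
    simp
  rw [gammaOne_mul_gammaOne_add, smul_mulVec, dotProduct_smul, add_mulVec, dotProduct_add, h1, h2, smul_eq_mul]
  push_cast
  ring

end PairHopRP

/-! ### (B.17)–(B.18) and (6.36) for the `π`-flux model -/

namespace KomaPiFlux

attribute [local instance] LiebCutRP.decEqTorus

variable {d L : ℕ} [NeZero L]

/-- Homogeneous variational principle `E₀ ‖v‖² ≤ Re⟨v, H v⟩`. [cite: Koma2022, App. B (B.17)] -/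
private theorem groundEnergy_mul_le_re {m : Type*} [Fintype m] [DecidableEq m] [Nonempty m] {K : Matrix m m ℂ}
    (hK : K.IsHermitian) (v : m → ℂ) : K.groundEnergy * (star v ⬝ᵥ v).re ≤ (star v ⬝ᵥ K *ᵥ v).re := by
  have h := (posSemidef_sub_groundEnergy hK).dotProduct_mulVec_nonneg v
  rw [sub_mulVec, dotProduct_sub, Algebra.algebraMap_eq_smul_one, smul_mulVec, one_mulVec, dotProduct_smul] at h
  obtain ⟨hre, -⟩ := Complex.nonneg_iff.mp h
  simp only [Complex.sub_re, Complex.real_smul, Complex.mul_re, Complex.ofReal_re, Complex.ofReal_im, zero_mul,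
    sub_zero] at hre
  linarith

/-- The Hamiltonian at `h = 0`, `B = 0` in `η`-spin form:
`H₀ = K(T_π) + (U/2 + g(d+1)) Σ_x P_x - (U|Λ|/4)·1 - (g/4) Σ_{x∼y}(Γ¹_xΓ¹_y + Γ²_xΓ²_y)`.
[cite: Koma2022, (3.4)–(3.7)] -/
theorem hamiltonian_zero_expand (h3 : 3 ≤ L) (κ U g : ℝ) :
    hamiltonian κ U g (fun (_ _ : FermionTorus (d + 1) L) => (0 : ℝ)) 0 =
      peierlsHubbard (G d L) (piFluxAmpl κ) 0 +
        ((U / 2 + g * (d + 1) : ℝ) : ℂ) • ∑ x : FermionTorus (d + 1) L, gammaOne x * gammaOne x -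
        ((U * (L : ℝ) ^ (d + 1) / 4 : ℝ) : ℂ) • (1 : Matrix _ _ ℂ) -
        ((g / 4 : ℝ) : ℂ) • ∑ x : FermionTorus (d + 1) L, ∑ y : FermionTorus (d + 1) L,
          (if (G d L).Adj x y then gammaOne x * gammaOne y + gammaTwo x * gammaTwo y else 0) := by
  have hcardC : (Fintype.card (FermionTorus (d + 1) L) : ℂ) = ((L : ℝ) : ℂ) ^ (d + 1) := by
    rw [show Fintype.card (FermionTorus (d + 1) L) = L ^ (d + 1) by
      simp only [FermionTorus, Fintype.card_lex, Fintype.card_fun, Fintype.card_fin]]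
    push_cast; ring
  unfold hamiltonian PairHopRP.hamiltonian
  rw [peierlsHubbard_eq_add_U (G d L) (piFluxAmpl κ) U, sum_hubbardU_eq, pairInteraction_zero_eq h3, Complex.ofReal_zero,
    zero_smul, sub_zero, hcardC]
  push_cast
  module

/-- **(B.17)–(B.18), Lieb frame**: for even `L ≥ 4`, `g ≥ 0`,
`E₀(H(κ,U,g,0,0)) ≤ U|Λ|/4 + g(d+1)|Λ|/2` (variational, with the `η`-pairing state of `|Λ|/2` pairs).
[cite: Koma2022, App. B (B.17)–(B.18)] [cite: Yang1989, eqs. (9)–(10)] -/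
theorem groundEnergy_hamiltonian_le (hL : Even L) (h4 : 4 ≤ L) (κ U : ℝ) {g : ℝ} (hg : 0 ≤ g) :
    (hamiltonian κ U g (fun (_ _ : FermionTorus (d + 1) L) => (0 : ℝ)) 0).groundEnergy ≤
      U * (L : ℝ) ^ (d + 1) / 4 + g * (d + 1) * (L : ℝ) ^ (d + 1) / 2 := by
  have h3 : 3 ≤ L := by omega
  set H₀ := hamiltonian κ U g (fun (_ _ : FermionTorus (d + 1) L) => (0 : ℝ)) 0 with hH₀
  have hH : H₀.IsHermitian := hamiltonian_isHermitian (G d L) (piFluxAmpl κ) (piFluxAmpl_herm κ) U g _ 0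
  -- the lattice size `M = L^{d+1} = 2k`
  set M := Fintype.card (FermionTorus (d + 1) L) with hM
  have hMeq : M = L ^ (d + 1) := by simp only [hM, FermionTorus, Fintype.card_lex, Fintype.card_fun, Fintype.card_fin]
  have hMeven : Even M := by rw [hMeq]; exact hL.pow_of_ne_zero (Nat.succ_ne_zero d)
  obtain ⟨k, hk⟩ := hMeven
  have hMpos : 2 ≤ M := by
    rw [hMeq]; exact le_trans (by omega : 2 ≤ L) (Nat.le_self_pow (Nat.succ_ne_zero d) L)
  have hk1 : 1 ≤ k := by omega
  have hMR : (M : ℝ) = (L : ℝ) ^ (d + 1) := by rw [hMeq]; push_cast; ring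
  -- the trial state
  obtain ⟨ψ, hψ⟩ : ∃ ψ : Fock (Orb (FermionTorus (d + 1) L)), ψ = etaPairingState (fun _ => (1 : ℤˣ)) k := ⟨_, rfl⟩
  have hψne : ψ ≠ 0 := by rw [hψ]; exact etaRaise_pow_mulVec_vacuum_ne_zero _ (by omega : k ≤ M)
  have hnorm_pos : 0 < (star ψ ⬝ᵥ ψ).re :=
    (Complex.pos_iff.mp (Matrix.dotProduct_star_self_pos_iff.mpr hψne)).1
  have hK : star ψ ⬝ᵥ (peierlsHubbard (G d L) (piFluxAmpl κ) 0 *ᵥ ψ) = 0 := by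
    rw [hψ]; exact star_dotProduct_peierlsHubbard_zero_etaPairingState _ _ _ _
  have hPx : ∀ x : FermionTorus (d + 1) L, star ψ ⬝ᵥ ((gammaOne x * gammaOne x) *ᵥ ψ) = star ψ ⬝ᵥ ψ := fun x => by
    rw [hψ]; exact star_dotProduct_proj_etaPairingState x _ k
  have hhop : ∀ x y : FermionTorus (d + 1) L, x ≠ y →
      star ψ ⬝ᵥ ((gammaOne x * gammaOne y + gammaTwo x * gammaTwo y) *ᵥ ψ) =
        ((4 * yangPairAmplitude M k : ℝ) : ℂ) * (star ψ ⬝ᵥ ψ) := fun x y hxy => by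
    rw [hψ, hM]; exact star_dotProduct_pairHop_etaPairingState hxy k
  -- the expectation of `H₀`
  have hyang : yangPairAmplitude M k = (k : ℝ) / (2 * (2 * k - 1)) := by
    rw [yangPairAmplitude, hk]; push_cast
    have : (k : ℝ) + k - 1 ≠ 0 := by
      have : (1 : ℝ) ≤ k := by exact_mod_cast hk1
      linarith
    field_simp
    ring
  have hexpH : (star ψ ⬝ᵥ (H₀ *ᵥ ψ)).re =
      ((U / 4 + g * (d + 1)) * (L : ℝ) ^ (d + 1) - 2 * g * (d + 1) * (L : ℝ) ^ (d + 1) * yangPairAmplitude M k) *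
        (star ψ ⬝ᵥ ψ).re := by
    rw [hH₀, hamiltonian_zero_expand h3, sub_mulVec, sub_mulVec, add_mulVec, dotProduct_sub, dotProduct_sub, dotProduct_add,
      hK, zero_add, smul_mulVec, smul_mulVec, smul_mulVec,
      dotProduct_smul, dotProduct_smul, dotProduct_smul, one_mulVec, Matrix.sum_mulVec, dotProduct_sum]
    simp_rw [hPx]
    rw [Finset.sum_const, Finset.card_univ, ← hM, Matrix.sum_mulVec, dotProduct_sum]
    have hpair : ∑ x : FermionTorus (d + 1) L, star ψ ⬝ᵥ ((∑ y : FermionTorus (d + 1) L,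
        (if (G d L).Adj x y then gammaOne x * gammaOne y + gammaTwo x * gammaTwo y else 0)) *ᵥ ψ) =
        ((2 * (d + 1 : ℕ) * M : ℕ) : ℂ) * (((4 * yangPairAmplitude M k : ℝ) : ℂ) * (star ψ ⬝ᵥ ψ)) := by
      have hterm : ∀ x y : FermionTorus (d + 1) L,
          star ψ ⬝ᵥ ((if (G d L).Adj x y then gammaOne x * gammaOne y + gammaTwo x * gammaTwo y else 0) *ᵥ ψ) =
          if (G d L).Adj x y then ((4 * yangPairAmplitude M k : ℝ) : ℂ) * (star ψ ⬝ᵥ ψ) else 0 := by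
        intro x y
        split_ifs with hxy
        · exact hhop x y ((G d L).ne_of_adj hxy)
        · rw [zero_mulVec, dotProduct_zero]
      simp_rw [Matrix.sum_mulVec, dotProduct_sum, hterm]
      rw [← sum_shift_add_sum_shift_swap h3 (fun (_ _ : FermionTorus (d + 1) L) =>
        ((4 * yangPairAmplitude M k : ℝ) : ℂ) * (star ψ ⬝ᵥ ψ))]
      simp only [Finset.sum_const, Finset.card_univ, Fintype.card_fin, nsmul_eq_mul]
      rw [← hM]; push_cast; ring
    rw [hpair]
    simp only [smul_eq_mul, nsmul_eq_mul, Complex.sub_re, Complex.mul_re, Complex.ofReal_re, Complex.ofReal_im,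
      Complex.natCast_re, Complex.natCast_im, zero_mul, sub_zero]
    push_cast
    rw [hMR]
    ring
  -- the variational principle
  have hvar := groundEnergy_mul_le_re hH ψ
  rw [hexpH] at hvar
  have hE : H₀.groundEnergy ≤ (U / 4 + g * (d + 1)) * (L : ℝ) ^ (d + 1) -
      2 * g * (d + 1) * (L : ℝ) ^ (d + 1) * yangPairAmplitude M k := le_of_mul_le_mul_right hvar hnorm_pos
  -- `yang(2k, k) = k/(2(2k-1)) ≥ 1/4`
  have hy : 1 / 4 ≤ yangPairAmplitude M k := by
    rw [hyang, div_le_div_iff₀ (by norm_num) (by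
      have : (1 : ℝ) ≤ k := by exact_mod_cast hk1
      nlinarith)]
    have : (1 : ℝ) ≤ k := by exact_mod_cast hk1
    nlinarith
  have hLD : (0 : ℝ) ≤ g * (d + 1) * (L : ℝ) ^ (d + 1) := by positivity
  nlinarith

/-- **Koma's (6.36), finite volume** (Lieb frame; even `L ≥ 4`, `β > 0`, `κ ≥ 0`, `g ≥ 0`): with
`N₁ = Σ_iΣ_x Re⟨Γ¹_xΓ¹_{x+e_i}⟩_β` in the Gibbs state of `H₀ = H(κ,U,g,0,0)`,
`g N₁ ≥ g(d+1)|Λ|/2 - {U + 2g(d+1)}₊|Λ|/2 - 4(d+1)κ|Λ| - |Λ| log 4/β`; i.e. for the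
nearest-neighbour correlation per bond `E₁ = N₁/((d+1)|Λ|)`:
`E₁ ≥ ½ - {U+2g(d+1)}₊/(2g(d+1)) - 4κ/g - log 4/(βg(d+1))` (Koma: `E₁ ≥ ½ - δ̃(β)/(dg) - |κ|/g` at
`U = -2(d+1)g`). [cite: Koma2022, (6.36), App. B (B.11), (B.18)] -/
theorem nearestNeighbour_ge (hL : Even L) (h4 : 4 ≤ L) {β : ℝ} (hβ : 0 < β) {κ : ℝ} (hκ : 0 ≤ κ) (U : ℝ)
    {g : ℝ} (hg : 0 ≤ g) :
    g * (d + 1) * (L : ℝ) ^ (d + 1) / 2 - max (U + 2 * g * (d + 1)) 0 * (L : ℝ) ^ (d + 1) / 2 -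
        4 * (d + 1) * κ * (L : ℝ) ^ (d + 1) - (L : ℝ) ^ (d + 1) * Real.log 4 / β ≤
      g * ∑ i : Fin (d + 1), ∑ x : FermionTorus (d + 1) L,
        pairCorr β (hamiltonian κ U g (fun (_ _ : FermionTorus (d + 1) L) => (0 : ℝ)) 0) x (shift x i) := by
  have h3 : 3 ≤ L := by omega
  have h1 := nearestNeighbour_lower_bound (d := d) h3 hβ hκ U g
  have h2 := groundEnergy_hamiltonian_le (d := d) hL h4 κ U hg
  have hLpos : (0 : ℝ) ≤ (L : ℝ) ^ (d + 1) := by positivity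
  -- `x + {-x}₊ = {x}₊` bookkeeping with `x = U/2 + g(d+1)`
  have hmax : max (U + 2 * g * (d + 1)) 0 / 2 = (U / 2 + g * (d + 1)) + max (-(U / 2 + g * (d + 1))) 0 := by
    rcases le_or_gt 0 (U / 2 + g * (d + 1)) with h | h
    · rw [max_eq_left (by linarith), max_eq_right (by linarith)]; ring
    · rw [max_eq_right (by linarith), max_eq_left (by linarith)]; ring
  have : max (U + 2 * g * (d + 1)) 0 * (L : ℝ) ^ (d + 1) / 2 =
      ((U / 2 + g * (d + 1)) + max (-(U / 2 + g * (d + 1))) 0) * (L : ℝ) ^ (d + 1) := by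
    rw [← hmax]; ring
  rw [this]
  nlinarith

end KomaPiFlux

end Literature.MathematicalPhysics.QuantumLattice

end
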